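import Mathlib
import Summits.Ventures.HodgeRepro2.Hypothesis
import Summits.Ventures.HodgeRepro2.BallActionU21
import Summits.Ventures.HodgeRepro2.InvariantFormsGroup
import Summits.Ventures.HodgeRepro2.Level
import Summits.Ventures.HodgeRepro2.LevelNeat
import Summits.Ventures.HodgeRepro2.DefiniteUnitaryBounded
import Summits.Ventures.HodgeRepro2.IntegralUnitaryDiscrete
import Summits.Ventures.HodgeRepro2.LevelDiscrete
import Summits.Ventures.HodgeRepro2.BallStabilizerBounded
import Summits.Ventures.HodgeRepro2.BallFreeAction
import Summits.Ventures.HodgeRepro2.BallMulAction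
import Summits.Ventures.HodgeRepro2.BallProperU21

/-!
# The quotient `Γ\𝔹²` is Hausdorff: the action of `Γ ⊆ Γ_N` is properly discontinuous

Shimura (J. Math. Soc. Japan 31 (1979), §4) and Dimitrov–Ramakrishnan (Doc. Math. 20 (2015), §2)
take `Γ\𝔹²` to be a compact complex surface.  The topological half of that — the quotient is a
Hausdorff space — follows from the discreteness of `Γ` (`LevelDiscrete.lean`) and the properness of
the `U(2,1)`-action (`BallProperU21.lean`), through Mathlib's
`t2Space_of_properlyDiscontinuousSMul_of_t2Space`.  This file assembles it for the frame action
`frameAction hQ S hS` of `BallMulAction.lean`: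

* `continuous_homog`, `IsInU21.continuous_ballAction_restrict` — the action of each element of
  `U(2,1)` on the ball is continuous;
* `continuousConstSMul_frameAction` — `ContinuousConstSMul S ball₂`; hence the quotient map
  `𝔹² → S\𝔹²` is an open quotient map and `S\𝔹²` is locally compact and second countable
  (`isOpenQuotientMap_ballQuotient_mk`, `locallyCompactSpace_ballQuotient`,
  `secondCountableTopology_ballQuotient`);
* `locallyCompactSpace_ball₂` — the ball is locally compact (an open subset of `ℂ²`);
* `properlyDiscontinuousSMul_frameAction` — **the action of any `S ⊆ Γ_N` on the ball is properly
  discontinuous**: for compact `K, L ⊆ 𝔹²` only finitely many `γ` have `γK ∩ L ≠ ∅` (the uniform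
  entry bound of `exists_uniform_entry_bound` + the finiteness of bounded subsets of `Γ_N`);
* `t2Space_ballQuotient` — **`S\𝔹²` is a Hausdorff space**; `t2Space_ballQuotient_shimuraLevel` /
  `t2Space_ballQuotient_of_isPicardSignature` — for Shimura's `Γ_N` and the data of
  `ShimuraThm81Instance`.

Compactness of `Γ\𝔹²` (the anisotropy of `H` over `K`) stays prose.
-/

open Matrix

namespace Summit.Ventures.HodgeRepro2.ShimuraData

/-- `homog : z ↦ (z, 1)` is continuous. -/
theorem continuous_homog : Continuous homog := by
  unfold homog
  refine continuous_pi fun i => ?_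
  refine Fin.lastCases ?_ (fun k => ?_) i
  · simp only [Fin.snoc_last]; exact continuous_const
  · simp only [Fin.snoc_castSucc]; exact continuous_apply k

/-- The action of a fixed `α ∈ U(2,1)` on the ball is continuous. -/
theorem IsInU21.continuous_ballAction_restrict {α : Matrix (Fin 3) (Fin 3) ℂ} (hα : IsInU21 α) :
    Continuous fun z : ball₂ => ballAction α z := by
  have hvec : Continuous fun z : ball₂ => α *ᵥ homog (z : Fin 2 → ℂ) :=
    continuous_const.matrix_mulVec (continuous_homog.comp continuous_subtype_val)
  have hden : Continuous fun z : ball₂ => (α *ᵥ homog (z : Fin 2 → ℂ)) (Fin.last 2) :=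
    (continuous_apply _).comp hvec
  refine continuous_pi fun k => ?_
  show Continuous fun z : ball₂ =>
    (α *ᵥ homog (z : Fin 2 → ℂ)) k.castSucc / (α *ᵥ homog (z : Fin 2 → ℂ)) (Fin.last 2)
  exact ((continuous_apply _).comp hvec).div hden fun z => hα.mulVec_homog_last_ne_zero z.2

/-- The ball is locally compact (an open subset of `ℂ²`). -/
theorem locallyCompactSpace_ball₂ : LocallyCompactSpace ball₂ :=
  isOpen_ball₂.locallyCompactSpace

section CMField

variable {K : Type*} [Field K] [NumberField K] [NumberField.IsCMField K]

/-- The frame action is continuous in the ball variable. -/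
theorem continuousConstSMul_frameAction {τ₁ : K →+* ℂ} {H : Matrix (Fin 3) (Fin 3) K}
    {Q : Matrix (Fin 3) (Fin 3) ℂ} (hQ : IsFrame K τ₁ H Q) (S : Subgroup (GL (Fin 3) K))
    (hS : (S : Set (GL (Fin 3) K)) ⊆ unitaryGroup K H) :
    letI := frameAction hQ S hS
    ContinuousConstSMul S ball₂ := by
  letI := frameAction hQ S hS
  refine ⟨fun γ => ?_⟩
  have hα : IsInU21 (realEmbedding K τ₁ Q γ) := hQ.isInU21_realEmbedding (hS γ.2)
  exact hα.continuous_ballAction_restrict.subtype_mk _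

/-- The quotient map `𝔹² → S\𝔹²` is an open quotient map (any `S ≤ U(H)`). -/
theorem isOpenQuotientMap_ballQuotient_mk {τ₁ : K →+* ℂ} {H : Matrix (Fin 3) (Fin 3) K}
    {Q : Matrix (Fin 3) (Fin 3) ℂ} (hQ : IsFrame K τ₁ H Q) (S : Subgroup (GL (Fin 3) K))
    (hS : (S : Set (GL (Fin 3) K)) ⊆ unitaryGroup K H) :
    IsOpenQuotientMap (ballQuotient.mk hQ S hS) := by
  letI := frameAction hQ S hS
  haveI := continuousConstSMul_frameAction hQ S hS
  exact MulAction.isOpenQuotientMap_quotientMk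

/-- `S\𝔹²` is locally compact (any `S ≤ U(H)`). -/
theorem locallyCompactSpace_ballQuotient {τ₁ : K →+* ℂ} {H : Matrix (Fin 3) (Fin 3) K}
    {Q : Matrix (Fin 3) (Fin 3) ℂ} (hQ : IsFrame K τ₁ H Q) (S : Subgroup (GL (Fin 3) K))
    (hS : (S : Set (GL (Fin 3) K)) ⊆ unitaryGroup K H) :
    LocallyCompactSpace (ballQuotient hQ S hS) := by
  haveI := locallyCompactSpace_ball₂
  exact (isOpenQuotientMap_ballQuotient_mk hQ S hS).locallyCompactSpace

/-- `S\𝔹²` is second countable (any `S ≤ U(H)`). -/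
theorem secondCountableTopology_ballQuotient {τ₁ : K →+* ℂ} {H : Matrix (Fin 3) (Fin 3) K}
    {Q : Matrix (Fin 3) (Fin 3) ℂ} (hQ : IsFrame K τ₁ H Q) (S : Subgroup (GL (Fin 3) K))
    (hS : (S : Set (GL (Fin 3) K)) ⊆ unitaryGroup K H) :
    SecondCountableTopology (ballQuotient hQ S hS) :=
  (isOpenQuotientMap_ballQuotient_mk hQ S hS).isQuotientMap.secondCountableTopology
    (isOpenQuotientMap_ballQuotient_mk hQ S hS).isOpenMap

/-- The image of the ball in `ℂ³` under `homog` consists of negative vectors. -/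
theorem hermJ21_neg_of_mem_image_homog {L : Set ball₂} {w : Fin 3 → ℂ}
    (hw : w ∈ homog '' (Subtype.val '' L)) : hermJ21 w < 0 := by
  obtain ⟨z, ⟨z', -, rfl⟩, rfl⟩ := hw
  exact (mem_ball₂_iff_hermJ21_homog_neg _).mp z'.2

/-- `α (homog z) = c • homog (ballAction α z)` for `α ∈ U(2,1)` and `z ∈ 𝔹²`. -/
theorem IsInU21.mulVec_homog_eq_smul_homog_ballAction {α : Matrix (Fin 3) (Fin 3) ℂ}
    (hα : IsInU21 α) {z : Fin 2 → ℂ} (hz : z ∈ ball₂) :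
    ∃ c : ℂ, α *ᵥ homog z = c • homog (ballAction α z) := by
  have hne := hα.mulVec_homog_last_ne_zero hz
  refine ⟨(α *ᵥ homog z) (Fin.last 2), ?_⟩
  rw [ballAction_eq_normalizeJ, homog_normalizeJ hne, smul_smul, mul_inv_cancel₀ hne, one_smul]

/-- **Proper discontinuity.**  For `S ⊆ Γ_N` (any lattice `𝔪`, `H` definite off `τ₁`, a frame
`Q`) and compact sets `K, L ⊆ 𝔹²`, only finitely many `γ ∈ S` satisfy `γK ∩ L ≠ ∅`. -/
theorem properlyDiscontinuousSMul_frameAction {τ₁ : K →+* ℂ} {H : Matrix (Fin 3) (Fin 3) K}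
    (hH : IsHermitianForm K H)
    (hdef : ∀ τ : K →+* ℂ, NumberField.InfinitePlace.mk τ ≠ NumberField.InfinitePlace.mk τ₁ →
      IsDefiniteAt K τ H)
    {Q : Matrix (Fin 3) (Fin 3) ℂ} (hQ : IsFrame K τ₁ H Q) {𝔪 : Submodule ℤ (Fin 3 → K)}
    (h𝔪 : IsLattice K 𝔪) {N : ℕ} {S : Subgroup (GL (Fin 3) K)}
    (hS : (S : Set (GL (Fin 3) K)) ⊆ shimuraLevel K H 𝔪 N) :
    letI := frameAction hQ S (subset_unitaryGroup_of_subset_shimuraLevel hS)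
    ProperlyDiscontinuousSMul S ball₂ := by
  letI := frameAction hQ S (subset_unitaryGroup_of_subset_shimuraLevel hS)
  refine ⟨fun {K' L} hK hL => ?_⟩
  -- the compact sets of negative vectors
  have hK1 : IsCompact (homog '' (Subtype.val '' K')) :=
    (hK.image continuous_subtype_val).image continuous_homog
  have hL1 : IsCompact (homog '' (Subtype.val '' L)) :=
    (hL.image continuous_subtype_val).image continuous_homog
  obtain ⟨B, hB⟩ := exists_uniform_entry_bound hK1 (fun _ hw => hermJ21_neg_of_mem_image_homog hw)
    hL1 (fun _ hw => hermJ21_neg_of_mem_image_homog hw)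
  -- the finite set of bounded elements of `S`
  have hfin := finite_of_subset_shimuraLevel hH τ₁ hdef h𝔪 hS
    ((3 * 3 : ℝ) * (entrySum Q⁻¹ * ((3 * 3 : ℝ) * B)) * entrySum Q)
  refine (hfin.preimage (f := fun γ : S => (γ : GL (Fin 3) K))
    Subtype.val_injective.injOn).subset ?_
  rintro γ ⟨z', ⟨z, hz, rfl⟩, hz'L⟩
  refine ⟨γ.2, norm_map_apply_le_of_realEmbedding_le hQ γ ?_⟩
  have hα : IsInU21 (realEmbedding K τ₁ Q γ) :=
    hQ.isInU21_realEmbedding (subset_unitaryGroup_of_subset_shimuraLevel hS γ.2)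
  obtain ⟨c, hc⟩ := hα.mulVec_homog_eq_smul_homog_ballAction z.2
  exact hB _ hα (homog z) ⟨z, ⟨z, hz, rfl⟩, rfl⟩ (homog ((γ • z : ball₂) : Fin 2 → ℂ))
    ⟨_, ⟨γ • z, hz'L, rfl⟩, rfl⟩ ⟨c, hc⟩

/-- **The quotient `S\𝔹²` is Hausdorff** for every `S ⊆ Γ_N`. -/
theorem t2Space_ballQuotient {τ₁ : K →+* ℂ} {H : Matrix (Fin 3) (Fin 3) K}
    (hH : IsHermitianForm K H)
    (hdef : ∀ τ : K →+* ℂ, NumberField.InfinitePlace.mk τ ≠ NumberField.InfinitePlace.mk τ₁ →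
      IsDefiniteAt K τ H)
    {Q : Matrix (Fin 3) (Fin 3) ℂ} (hQ : IsFrame K τ₁ H Q) {𝔪 : Submodule ℤ (Fin 3 → K)}
    (h𝔪 : IsLattice K 𝔪) {N : ℕ} {S : Subgroup (GL (Fin 3) K)}
    (hS : (S : Set (GL (Fin 3) K)) ⊆ shimuraLevel K H 𝔪 N) :
    T2Space (ballQuotient hQ S (subset_unitaryGroup_of_subset_shimuraLevel hS)) := by
  letI := frameAction hQ S (subset_unitaryGroup_of_subset_shimuraLevel hS)
  haveI := continuousConstSMul_frameAction hQ S (subset_unitaryGroup_of_subset_shimuraLevel hS)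
  haveI := properlyDiscontinuousSMul_frameAction hH hdef hQ h𝔪 hS
  haveI := locallyCompactSpace_ball₂
  exact t2Space_of_properlyDiscontinuousSMul_of_t2Space

/-- **Shimura's `Γ_N\𝔹²` is Hausdorff** (every `N`, every lattice). -/
theorem t2Space_ballQuotient_shimuraLevel {τ₁ : K →+* ℂ} {H : Matrix (Fin 3) (Fin 3) K}
    (hH : IsHermitianForm K H)
    (hdef : ∀ τ : K →+* ℂ, NumberField.InfinitePlace.mk τ ≠ NumberField.InfinitePlace.mk τ₁ →
      IsDefiniteAt K τ H)
    {Q : Matrix (Fin 3) (Fin 3) ℂ} (hQ : IsFrame K τ₁ H Q) {𝔪 : Submodule ℤ (Fin 3 → K)}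
    (h𝔪 : IsLattice K 𝔪) (N : ℕ) :
    T2Space (ballQuotient hQ (shimuraLevelSubgroup K H 𝔪 N)
      (subset_unitaryGroup_of_subset_shimuraLevel (coe_shimuraLevelSubgroup K H 𝔪 N).subset)) :=
  t2Space_ballQuotient hH hdef hQ h𝔪 (coe_shimuraLevelSubgroup K H 𝔪 N).subset

/-- **For the data of `ShimuraThm81Instance`** (a Hermitian form of Picard signature at `τ₁`, a
lattice and a frame), `Γ_N\𝔹²` is Hausdorff for every `N` — in particular for the group `Γ_1` of
`NonVanishingInput`. -/
theorem t2Space_ballQuotient_of_isPicardSignature {τ₁ : K →+* ℂ} {H : Matrix (Fin 3) (Fin 3) K}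
    (hH : IsHermitianForm K H) (hP : IsPicardSignature K τ₁ H)
    {Q : Matrix (Fin 3) (Fin 3) ℂ} (hQ : IsFrame K τ₁ H Q) {𝔪 : Submodule ℤ (Fin 3 → K)}
    (h𝔪 : IsLattice K 𝔪) (N : ℕ) :
    T2Space (ballQuotient hQ (shimuraLevelSubgroup K H 𝔪 N)
      (subset_unitaryGroup_of_subset_shimuraLevel (coe_shimuraLevelSubgroup K H 𝔪 N).subset)) :=
  t2Space_ballQuotient_shimuraLevel hH hP.isDefiniteAt_of_ne hQ h𝔪 N

end CMField

end Summit.Ventures.HodgeRepro2.ShimuraData
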